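import Summits.QuantumFields.YangMills.Theorems.TwistedTraceScaling.Negative.ConstProximityKit
import HarnessLib

/-!
# Negative lemma R9 for crux `TwistedTraceScaling` (stmt-QuantumFields-20203): near-CONSTANT `S^α`-proximity (`α > 1/4`, incl. `√σ`) is false at
# every EVEN `L` — the centre-twisted constants are a second family of quartic valleys

Standing disprover `ym-cdisprove-20203-1` (gen 9), skeleton of record «twolattice» rev 3 (stubs `stub_fixedLatticeTraceLaw` = S-BASE, lanes A/B;
`stub_cmpTwoLoop`).  Cycle 8 (`Negative/FlatProximityQuartic.lean`, `…Exponent.lean`) refuted the `√σ`-to-FLAT brick of lane B's blueprint and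
named the repair «`S^{1/4}` to Flat, or `√σ` to the CONSTANT (zero-momentum) configurations».  The second half of that repair line — and lane B's
reworded §5 «modulo gauge all links within `C·√S` of a constant configuration» — is refuted here at every fixed EVEN `L ≥ 2`, for every exponent
`α > 1/4` (`constProximity_rpow_false`, `constProximity_sqrt_false`):

  `¬ ∃ C σ₀ > 0, ∀ U, S(U) ≤ σ₀ → ∃ g c, ∀ e, ‖(g·U)_e − c_{e.2}‖_F ≤ C·S(U)^α`.

Witness: 't Hooft's centre twist `twist 2 (−1) (twoLinkCfg a_φ b_φ)` (kit `Negative/ConstProximityKit.lean`).  Its action is that of the two-link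
configuration, `≤ 4·#Plaquette·sin⁴φ`; its direction-2 Polyakov loop through the origin is EXACTLY `−1`, its `(i,2)` plaquettes are trivial, its
direction-0/1 loops are `a^L`, `b^L`.  If `g·U` is `δ`-close to the constant `c`, then (Polyakov loops are conjugated, plaquettes covariant under
gauge) `‖−1 − c₂^L‖ ≤ Lδ`, `‖1 − [c_k, c₂]‖ ≤ 4δ` (`k = 0,1`), `‖g₀ a^L g₀⁻¹ − c₀^L‖, ‖g₀ b^L g₀⁻¹ − c₁^L‖ ≤ Lδ`.  For EVEN `L = 2m` the first forces
`m²|Im c₂|² ≥ 1 − Lδ/2` (even-power rigidity), the second `|Im c_k × Im c₂|² ≤ 2δ²`, so `c₀, c₁` have COMMUTING shadows `Y₀, Y₁` on the axis of `c₂`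
with `‖c_k − Y_k‖ ≤ 2Lδ`; powers are `L`-Lipschitz, so `(g₀⁻¹Y₀^Lg₀, g₀⁻¹Y₁^Lg₀)` is a commuting pair within `L(1+2L)δ` of `(a^L, b^L)` and R8's
`sq_le_of_commute_near_axes` gives `sin²(Lφ) ≤ 2(L(1+2L)δ)²` — linear in `φ`, against `δ ≤ C(Kφ⁴)^α`, `4α > 1`: contradiction as `φ → 0⁺`
(`sin_sq_le_of_near_const` + R8's `flatProximity_endgame_rpow`).  So at even `L` the distance from the gauge orbit of the witness to the constants is
`≍ φ ≍ S^{1/4}` (lower bound `≳ φ/L` here; upper bound `O(φ)`: at `φ = 0` the witness is flat with holonomies `(1,1,−1)`, a gauge copy of the constant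
`(1,1,c)`, `c^L = −1` — NON-central when `L` is even, so the valley through it consists of the non-constant «spirals» `x ↦ (c^{−x₂}a_φc^{x₂},
c^{−x₂}b_φc^{x₂}, c)`).  For ODD `L` the witness is a gauge copy of the constant `(a_φ, b_φ, −1)` (gauge function `t ↦ (−1)^{[t even, t ≠ 0]}` along
direction 2, periodic iff `L` is odd) and refutes nothing; whether `√σ`-proximity to the constants holds at odd `L` is left open.
(Erratum to the kit's docblock: its phrase «`≍ 1/L` away from the gauge orbit of the constants» should read «at distance `≍ φ ≍ S^{1/4}`, i.e. not
`O(S^α)` for any `α > 1/4`»; the kit's theorems are unaffected.)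
## Message to the lanes (BO-vs-BH pre-vet, owner task (c))
Flat `SU(2)` fields on `(ℤ/L)³` are the gauge copies of COMMUTING constants, so R8's surviving brick «`S^{1/4}`-proximity to FLAT» is also
`S^{1/4}`-proximity to the constants; the present lemma says that at EVEN `L` (in particular `L₀ = 2`) no better rate to the constants exists.  The
mechanism is Lüscher's: at each of the eight flat points with CENTRAL holonomies `ε ∈ {±1}³` the local system `Ad ρ_ε` is trivial, so the Hessian of
`S` has `9` zero modes (beyond gauge), `6` of them quartic; at `ε ≠ (1,1,1)` and even `L` these points are constant only in a gauge where the zero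
modes are spirals, not constants.  A Laplace/BO text built on a chart «constants + Gaussian transverse fluctuations» is therefore wrong near seven of
the eight toron points at even `L`; work near FLAT at the `S^{1/4}` scale, or treat the eight sectors explicitly (twist-invariant = `IsPhys` integrands
see all eight with equal weight).
## WHAT THIS IS NOT
Not `¬TwistedTraceScaling`, not `¬stub_fixedLatticeTraceLaw`, not `¬stub_cmpTwoLoop`: a fixed-lattice geometric fact refuting an AUXILIARY
formulation.  HONEST FRAMING: femto rung R2b1, stub support of a child of a CONDITIONAL reduction route; nothing about the continuum or the Clay gap.
Sorry-free, no new definition; axioms ⊆ {propext, Classical.choice, Quot.sound}.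
-/

set_option autoImplicit false

noncomputable section

open scoped Matrix Quaternion BigOperators
open Literature.MathematicalPhysics.QuantumFieldTheory hiding SU2
open Literature.MathematicalPhysics.QuantumLattice
open Summit.QuantumFields.YangMills.Theorems.FemtoTransferGap
open Summit.QuantumFields.YangMills.Theorems.FemtoTransferGap.PhysL2 (twoLinkCfg plaquetteHolonomy_twoLinkCfg scalarPart_comm_eq)
open Summit.QuantumFields.YangMills.Theorems.FemtoTransferGap.TwoLattice.Chart (frobNorm_sub_sq_eq)
open Summit.QuantumFields.YangMills.Theorems.TwistedTraceScaling.Negative.R8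


namespace Summit.QuantumFields.YangMills.Theorems.TwistedTraceScaling.Negative.R9

/-! ## §1 Commuting shadows -/

section Shadow


/-- `su2Quat` is multiplicative (tree). [folklore] -/
private theorem quat_mul' (U W : SU2) : su2Quat (U * W) = su2Quat U * su2Quat W := Balaban1983to89.T4HaarSU2Translate.su2Quat_mul U W

/-- The real core of the commuting shadow: projecting a unit vector `x ∈ ℝ⁴` onto the plane `span(e₀, (0,n))` and normalising moves it by
at most `√2·|x⃗ × n|/|n|` (when `|x⃗ × n|² ≤ κ ≤ |n|²/2`). [folklore] -/
theorem shadow_real {x0 x1 x2 x3 n1 n2 n3 κ : ℝ} (hx : x0 ^ 2 + x1 ^ 2 + x2 ^ 2 + x3 ^ 2 = 1)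
    (hκ : (x1 ^ 2 + x2 ^ 2 + x3 ^ 2) * (n1 ^ 2 + n2 ^ 2 + n3 ^ 2) - (x1 * n1 + x2 * n2 + x3 * n3) ^ 2 ≤ κ)
    (hsmall : 2 * κ ≤ n1 ^ 2 + n2 ^ 2 + n3 ^ 2) (hpos : 0 < n1 ^ 2 + n2 ^ 2 + n3 ^ 2) :
    ∃ r t : ℝ, r ^ 2 + t ^ 2 * (n1 ^ 2 + n2 ^ 2 + n3 ^ 2) = 1 ∧
      ((x0 - r) ^ 2 + (x1 - t * n1) ^ 2 + (x2 - t * n2) ^ 2 + (x3 - t * n3) ^ 2) * (n1 ^ 2 + n2 ^ 2 + n3 ^ 2) ≤ 2 * κ := by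
  set ν := n1 ^ 2 + n2 ^ 2 + n3 ^ 2 with hν
  set d := x1 * n1 + x2 * n2 + x3 * n3 with hd
  have hlag : (x1 ^ 2 + x2 ^ 2 + x3 ^ 2) * ν - d ^ 2 = (x1 * n2 - x2 * n1) ^ 2 + (x2 * n3 - x3 * n2) ^ 2 + (x3 * n1 - x1 * n3) ^ 2 := by
    simp only [hν, hd]; ring
  have hlag0 : 0 ≤ (x1 ^ 2 + x2 ^ 2 + x3 ^ 2) * ν - d ^ 2 := by rw [hlag]; positivity
  set R := x0 ^ 2 + (d / ν) ^ 2 * ν with hR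
  have hRν : R * ν = ν - ((x1 ^ 2 + x2 ^ 2 + x3 ^ 2) * ν - d ^ 2) := by
    have : (d / ν) ^ 2 * ν * ν = d ^ 2 := by field_simp
    simp only [hR]; linear_combination ν * hx + this
  have hR1 : R ≤ 1 := le_of_mul_le_mul_right (by linarith) hpos
  have hR2 : 1 / 2 ≤ R := le_of_mul_le_mul_right (by linarith) hpos
  have hR0 : 0 < R := by linarith
  set ρ := Real.sqrt R with hρ
  have hρ2 : ρ ^ 2 = R := Real.sq_sqrt hR0.le
  have hρ0 : 0 < ρ := Real.sqrt_pos.2 hR0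
  have hρ1 : ρ ≤ 1 := by have h := Real.sqrt_le_sqrt hR1; rwa [Real.sqrt_one] at h
  have hunit : (x0 / ρ) ^ 2 + (d / ν / ρ) ^ 2 * ν = 1 := by
    rw [show (x0 / ρ) ^ 2 + (d / ν / ρ) ^ 2 * ν = R * (ρ ^ 2)⁻¹ by simp only [hR]; ring, hρ2, mul_inv_cancel₀ hR0.ne']
  have hq : (x0 * (x0 / ρ) + d / ν / ρ * d) * ρ = ρ ^ 2 := by
    calc (x0 * (x0 / ρ) + d / ν / ρ * d) * ρ = x0 * (x0 / ρ * ρ) + d / ν / ρ * ρ * d := by ring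
      _ = x0 * x0 + d / ν * d := by rw [div_mul_cancel₀ _ hρ0.ne', div_mul_cancel₀ _ hρ0.ne']
      _ = R := by simp only [hR]; field_simp; try ring
      _ = ρ ^ 2 := hρ2.symm
  have hq' : x0 * (x0 / ρ) + d / ν / ρ * d = ρ := by
    rw [sq] at hq; exact mul_right_cancel₀ hρ0.ne' hq
  refine ⟨x0 / ρ, d / ν / ρ, hunit, ?_⟩
  have hD : (x0 - x0 / ρ) ^ 2 + (x1 - d / ν / ρ * n1) ^ 2 + (x2 - d / ν / ρ * n2) ^ 2 + (x3 - d / ν / ρ * n3) ^ 2 = 2 - 2 * ρ := by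
    have e : (x0 - x0 / ρ) ^ 2 + (x1 - d / ν / ρ * n1) ^ 2 + (x2 - d / ν / ρ * n2) ^ 2 + (x3 - d / ν / ρ * n3) ^ 2 =
        (x0 ^ 2 + x1 ^ 2 + x2 ^ 2 + x3 ^ 2) - 2 * (x0 * (x0 / ρ) + d / ν / ρ * d) + ((x0 / ρ) ^ 2 + (d / ν / ρ) ^ 2 * ν) := by
      simp only [hd, hν]; ring
    rw [e, hx, hq', hunit]; ring
  rw [hD]
  have h1 : 2 - 2 * ρ ≤ 2 * (1 - R) := by nlinarith
  calc (2 - 2 * ρ) * ν ≤ 2 * (1 - R) * ν := mul_le_mul_of_nonneg_right h1 hpos.le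
    _ = 2 * ((x1 ^ 2 + x2 ^ 2 + x3 ^ 2) * ν - d ^ 2) := by linear_combination (-2 : ℝ) * hRν
    _ ≤ 2 * κ := by linarith

/-- **Commuting shadow.**  If `|Im X × Im N|² ≤ κ` and `|Im N|² ≥ 2κ > 0`, there is `Y ∈ SU(2)` with `Im Y ∥ Im N` and
`‖X − Y‖_F²·|Im N|² ≤ 4κ`. [folklore] -/
theorem exists_commuting_shadow (X N : SU2) {κ : ℝ} (hκ : (vecPart X ⨯₃ vecPart N) ⬝ᵥ (vecPart X ⨯₃ vecPart N) ≤ κ)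
    (hsmall : 2 * κ ≤ ∑ i, vecPart N i ^ 2) (hpos : 0 < ∑ i, vecPart N i ^ 2) :
    ∃ (Y : SU2) (r t : ℝ), su2Quat Y = ⟨r, t * (su2Quat N).imI, t * (su2Quat N).imJ, t * (su2Quat N).imK⟩ ∧
      frobNorm ((X : Matrix (Fin 2) (Fin 2) ℂ) - (Y : Matrix (Fin 2) (Fin 2) ℂ)) ^ 2 * ∑ i, vecPart N i ^ 2 ≤ 4 * κ := by
  rw [cross_dot_self_eq] at hκ
  rw [Fin.sum_univ_three] at hsmall hpos ⊢
  have hx : scalarPart X ^ 2 + vecPart X 0 ^ 2 + vecPart X 1 ^ 2 + vecPart X 2 ^ 2 = 1 := by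
    have := scalarPart_sq_add X; rw [Fin.sum_univ_three] at this; linarith
  obtain ⟨r, t, hunit, hdist⟩ := shadow_real hx hκ hsmall hpos
  have hq : Quaternion.normSq (⟨r, t * (su2Quat N).imI, t * (su2Quat N).imJ, t * (su2Quat N).imK⟩ : ℍ) = 1 := by
    rw [Quaternion.normSq_def']; change r ^ 2 + (t * vecPart N 0) ^ 2 + (t * vecPart N 1) ^ 2 + (t * vecPart N 2) ^ 2 = 1
    linear_combination hunit
  obtain ⟨Y, hY⟩ := exists_su2Quat_eq _ hq
  obtain ⟨hYr, hY0, hY1, hY2⟩ := entries_of_su2Quat_eq hY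
  refine ⟨Y, r, t, hY, ?_⟩
  rw [frobNorm_sub_sq_eq, Fin.sum_univ_three, scalarPart_eq Y, vecPart_zero Y, vecPart_one Y, vecPart_two Y, hYr, hY0, hY1, hY2]
  change 2 * ((scalarPart X - r) ^ 2 + ((vecPart X 0 - t * vecPart N 0) ^ 2 + (vecPart X 1 - t * vecPart N 1) ^ 2 +
    (vecPart X 2 - t * vecPart N 2) ^ 2)) * (vecPart N 0 ^ 2 + vecPart N 1 ^ 2 + vecPart N 2 ^ 2) ≤ 4 * κ
  linarith

/-- **Two shadows on the same axis commute.** [folklore] -/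
theorem comm_of_parallel {Y Y' N : SU2} {r t r' t' : ℝ}
    (hY : su2Quat Y = ⟨r, t * (su2Quat N).imI, t * (su2Quat N).imJ, t * (su2Quat N).imK⟩)
    (hY' : su2Quat Y' = ⟨r', t' * (su2Quat N).imI, t' * (su2Quat N).imJ, t' * (su2Quat N).imK⟩) : Y * Y' = Y' * Y :=
  eq_of_su2Quat_eq (by rw [quat_mul', quat_mul', hY, hY']; ext <;> (simp; try ring))

end Shadow

/-! ## §2 ★ The refutation -/

section Main


/-- **The geometric core.**  On an even lattice `L = 2m`, suppose the gauge-transformed sheet witness is link-wise `δ`-close to the constant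
configuration `c` with `Lδ ≤ 1/2`, packaged as the five loop facts it implies at the origin: the three Polyakov loops (`g₀ a^L g₀⁻¹ ≈ c₀^L`,
`g₀ b^L g₀⁻¹ ≈ c₁^L`, `−1 ≈ c₂^L`, each within `Lδ`) and the two mixed plaquettes (`1 ≈ [c₀,c₂]`, `1 ≈ [c₁,c₂]`, within `4δ`).  Then
`sin²(Lφ) ≤ 2(L(1+2L)δ)²`: even-power rigidity makes `|Im c₂| ≳ 1/L`, almost-commutation puts `c₀`, `c₁` within `2Lδ` of two COMMUTING shadows on
the axis of `c₂`, powers and conjugation carry this to a commuting pair within `L(1+2L)δ` of `(a^L, b^L)`, and R8's `sq_le_of_commute_near_axes`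
finishes. [folklore] -/
theorem sin_sq_le_of_near_const {L m : ℕ} (hm : L = m + m) (hL : 0 < L) {a b g₀ : SU2} {c : Fin 3 → SU2} {φ δ : ℝ}
    (ha : su2Quat a = ⟨Real.cos φ, Real.sin φ, 0, 0⟩) (hb : su2Quat b = ⟨Real.cos φ, 0, Real.sin φ, 0⟩)
    (hsL : 0 < Real.sin (L * φ)) (hε : (L : ℝ) * δ ≤ 1 / 2)
    (hd0 : frobNorm (((g₀ * a ^ L * g₀⁻¹ : SU2) : Matrix (Fin 2) (Fin 2) ℂ) - ((c 0 ^ L : SU2) : Matrix (Fin 2) (Fin 2) ℂ)) ≤ L * δ)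
    (hd1 : frobNorm (((g₀ * b ^ L * g₀⁻¹ : SU2) : Matrix (Fin 2) (Fin 2) ℂ) - ((c 1 ^ L : SU2) : Matrix (Fin 2) (Fin 2) ℂ)) ≤ L * δ)
    (hd2 : frobNorm (((negOne : SU2) : Matrix (Fin 2) (Fin 2) ℂ) - ((c 2 ^ L : SU2) : Matrix (Fin 2) (Fin 2) ℂ)) ≤ L * δ)
    (hp0 : frobNorm (1 - ((c 0 * c 2 * (c 0)⁻¹ * (c 2)⁻¹ : SU2) : Matrix (Fin 2) (Fin 2) ℂ)) ≤ 4 * δ)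
    (hp1 : frobNorm (1 - ((c 1 * c 2 * (c 1)⁻¹ * (c 2)⁻¹ : SU2) : Matrix (Fin 2) (Fin 2) ℂ)) ≤ 4 * δ) :
    Real.sin (L * φ) ^ 2 ≤ 2 * (L * ((1 + 2 * L) * δ)) ^ 2 := by
  have hδ0 : 0 ≤ δ := by linarith [(frobNorm_nonneg _).trans hp0]
  have hLr : (0 : ℝ) < L := Nat.cast_pos.2 hL
  have hmL : (m : ℝ) = L / 2 := by rw [hm]; push_cast; ring
  have hm0 : (0 : ℝ) < (m : ℝ) ^ 2 := by rw [hmL]; positivity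
  -- (1) even-power rigidity for `c 2`
  set ν := ∑ i, vecPart (c 2) i ^ 2 with hν
  have hA : 1 - L * δ / 2 ≤ (m : ℝ) ^ 2 * ν := even_power_rigidity (c 2) m (by rw [← hm]; exact hd2)
  have hmν : 3 / 4 ≤ (m : ℝ) ^ 2 * ν := by nlinarith
  have hν0 : 0 < ν := by
    by_contra h
    have : (m : ℝ) ^ 2 * ν ≤ 0 := mul_nonpos_of_nonneg_of_nonpos hm0.le (not_lt.1 h)
    linarith
  -- (2) almost-commutation with `c 2`
  have hκ0 := cross_sq_le_of_comm_near_one hp0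
  have hκ1 := cross_sq_le_of_comm_near_one hp1
  rw [show (4 * δ) ^ 2 / 8 = 2 * δ ^ 2 by ring] at hκ0 hκ1
  have hLδ : (m : ℝ) ^ 2 * (4 * δ ^ 2) = (L * δ) ^ 2 := by rw [hmL]; ring
  have hLδ2 : ((L : ℝ) * δ) ^ 2 ≤ 1 / 4 := by nlinarith [mul_nonneg hLr.le hδ0]
  have hsmall : 2 * (2 * δ ^ 2) ≤ ν := by
    by_contra hcon
    have : (m : ℝ) ^ 2 * ν < (m : ℝ) ^ 2 * (4 * δ ^ 2) := mul_lt_mul_of_pos_left (by linarith) hm0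
    linarith
  -- (3) commuting shadows `Y0`, `Y1` of `c 0`, `c 1` on the axis of `c 2`
  obtain ⟨Y0, r0, t0, hY0, hY0d⟩ := exists_commuting_shadow (c 0) (c 2) hκ0 hsmall hν0
  obtain ⟨Y1, r1, t1, hY1, hY1d⟩ := exists_commuting_shadow (c 1) (c 2) hκ1 hsmall hν0
  have hcomm : Y0 * Y1 = Y1 * Y0 := comm_of_parallel hY0 hY1
  have hdist : ∀ {F : ℝ}, 0 ≤ F → F ^ 2 * ν ≤ 4 * (2 * δ ^ 2) → F ≤ 2 * L * δ := fun {F} hF h => by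
    have h1 : F ^ 2 * ((m : ℝ) ^ 2 * ν) ≤ 2 * (L * δ) ^ 2 := by nlinarith [hm0.le]
    have h2 : F ^ 2 * (3 / 4) ≤ F ^ 2 * ((m : ℝ) ^ 2 * ν) := mul_le_mul_of_nonneg_left hmν (sq_nonneg F)
    have h3 : F ^ 2 ≤ (2 * L * δ) ^ 2 := by nlinarith
    exact (pow_le_pow_iff_left₀ hF (by positivity) two_ne_zero).1 h3
  have hF0 : frobNorm ((c 0 : Matrix (Fin 2) (Fin 2) ℂ) - (Y0 : Matrix (Fin 2) (Fin 2) ℂ)) ≤ 2 * L * δ := hdist (frobNorm_nonneg _) hY0d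
  have hF1 : frobNorm ((c 1 : Matrix (Fin 2) (Fin 2) ℂ) - (Y1 : Matrix (Fin 2) (Fin 2) ℂ)) ≤ 2 * L * δ := hdist (frobNorm_nonneg _) hY1d
  -- (4) powers, triangle, conjugation
  have hP0 : frobNorm (((c 0 ^ L : SU2) : Matrix (Fin 2) (Fin 2) ℂ) - ((Y0 ^ L : SU2) : Matrix (Fin 2) (Fin 2) ℂ)) ≤ L * (2 * L * δ) :=
    (frobNorm_pow_sub_pow_le' (c 0) Y0 L).trans (mul_le_mul_of_nonneg_left hF0 (Nat.cast_nonneg L))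
  have hP1 : frobNorm (((c 1 ^ L : SU2) : Matrix (Fin 2) (Fin 2) ℂ) - ((Y1 ^ L : SU2) : Matrix (Fin 2) (Fin 2) ℂ)) ≤ L * (2 * L * δ) :=
    (frobNorm_pow_sub_pow_le' (c 1) Y1 L).trans (mul_le_mul_of_nonneg_left hF1 (Nat.cast_nonneg L))
  have hC0 : frobNorm (((a ^ L : SU2) : Matrix (Fin 2) (Fin 2) ℂ) - ((g₀⁻¹ * Y0 ^ L * g₀ : SU2) : Matrix (Fin 2) (Fin 2) ℂ)) ≤ L * ((1 + 2 * L) * δ) := by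
    rw [← frobNorm_conj_sub]
    have := (frobNorm_sub_le_of_mid _ ((c 0 ^ L : SU2) : Matrix (Fin 2) (Fin 2) ℂ) _).trans (add_le_add hd0 hP0)
    linarith
  have hC1 : frobNorm (((b ^ L : SU2) : Matrix (Fin 2) (Fin 2) ℂ) - ((g₀⁻¹ * Y1 ^ L * g₀ : SU2) : Matrix (Fin 2) (Fin 2) ℂ)) ≤ L * ((1 + 2 * L) * δ) := by
    rw [← frobNorm_conj_sub]
    have := (frobNorm_sub_le_of_mid _ ((c 1 ^ L : SU2) : Matrix (Fin 2) (Fin 2) ℂ) _).trans (add_le_add hd1 hP1)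
    linarith
  set A := Y0 ^ L with hAdef
  set B := Y1 ^ L with hBdef
  have hAB : A * B = B * A := (Commute.pow_pow hcomm L L).eq
  have hXY : g₀⁻¹ * A * g₀ * (g₀⁻¹ * B * g₀) = g₀⁻¹ * B * g₀ * (g₀⁻¹ * A * g₀) := by
    calc g₀⁻¹ * A * g₀ * (g₀⁻¹ * B * g₀) = g₀⁻¹ * (A * B) * g₀ := by group
      _ = g₀⁻¹ * (B * A) * g₀ := by rw [hAB]
      _ = g₀⁻¹ * B * g₀ * (g₀⁻¹ * A * g₀) := by group
  exact sq_le_of_commute_near_axes hXY hsL (su2Quat_pow_axisI ha L) (su2Quat_pow_axisJ hb L) hC0 hC1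
set_option maxHeartbeats 400000 in
/-- ★ **R9. Near-CONSTANT `S^α`-proximity is false at every EVEN `L`, for every `α > 1/4`.**  There are no constants `C`, `σ₀ > 0` such that
every `SU(2)` lattice gauge field `U` on `(ℤ/L)³`, `L` even, with Wilson action `S(U) ≤ σ₀` is gauge-equivalent to a configuration all of whose
links are within Frobenius distance `C·S(U)^α` of a CONSTANT configuration (`c e.2` on every direction-`e.2` link).  Witness: 't Hooft's centre
twist `twist 2 negOne (twoLinkCfg a_φ b_φ)` of the two-link configuration — the SAME action `≤ 4·#Plaquette·sin⁴φ` (the tree's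
`wilsonAction_twist_of_mem_center`: a thin centre vortex sheet is invisible to plaquettes), but its direction-2 Polyakov loop is EXACTLY `−1`
while its `(0,1)` plaquettes vanish only to order `φ⁴`: for even `L` the gauge orbit stays `≳ φ/L` away from the constants (even-power rigidity of
`c₂`, almost-commutation, commuting shadows, R8's endgame).  The surviving fixed-`L` statement is `S^{1/4}`-proximity to FLAT = to the commuting
constants (R8); for odd `L` this witness is a gauge copy of the constant `(a_φ, b_φ, −1)` and says nothing. [cite: Luscher1983, §2] [cite: tHooft1979] -/
theorem constProximity_rpow_false (L : ℕ) [NeZero L] (hLe : Even L) {α : ℝ} (hα : 1 / 4 < α) :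
    ¬ ∃ C σ₀ : ℝ, 0 < σ₀ ∧ ∀ U : GaugeConfig 3 L SU2, wilsonAction su2Rep U ≤ σ₀ →
        ∃ (g : Site 3 L → SU2) (c : Fin 3 → SU2),
          ∀ e, frobNorm (((gaugeTransform g U e : SU2) : Matrix (Fin 2) (Fin 2) ℂ) - ((c e.2 : SU2) : Matrix (Fin 2) (Fin 2) ℂ)) ≤ C * wilsonAction su2Rep U ^ α := by
  rintro ⟨C, σ₀, hσ₀, H⟩
  obtain ⟨m, hm⟩ := hLe
  have hLnat : 0 < L := Nat.pos_of_ne_zero (NeZero.ne L)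
  -- constants of the lattice, the exponent gap and a small angle
  set K : ℝ := 4 * (Fintype.card (Plaquette 3 L) : ℝ) with hK
  have hK0 : 0 ≤ K := by positivity
  have hLpos : (0 : ℝ) < L := Nat.cast_pos.2 hLnat
  have hπ := Real.pi_pos
  have hα0 : 0 ≤ α := by linarith
  have h4α : 1 ≤ 4 * α := by linarith
  have he : 0 < 8 * α - 2 := by linarith
  have hKα0 : 0 ≤ K ^ α := Real.rpow_nonneg hK0 α
  set C₁ : ℝ := (1 + 2 * L) * C with hC₁
  have hM1 : 0 < Real.pi ^ 2 * C₁ ^ 2 * (K ^ α) ^ 2 + 1 := by positivity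
  have hM2 : 0 < 2 * L * |C| * K ^ α + 1 := by positivity
  set φ : ℝ := min (min 1 (Real.pi / 2 / L))
    (min (σ₀ / (K + 1)) (min ((1 / (Real.pi ^ 2 * C₁ ^ 2 * (K ^ α) ^ 2 + 1)) ^ (8 * α - 2)⁻¹) (1 / (2 * L * |C| * K ^ α + 1)))) with hφ
  have hφ0 : 0 < φ := lt_min (lt_min one_pos (div_pos (by positivity) hLpos))
    (lt_min (by positivity) (lt_min (Real.rpow_pos_of_pos (by positivity) _) (by positivity)))
  have hφ1 : φ ≤ 1 := (min_le_left _ _).trans (min_le_left _ _)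
  have hφL : (L : ℝ) * φ ≤ Real.pi / 2 := by
    have h : φ ≤ Real.pi / 2 / L := (min_le_left _ _).trans (min_le_right _ _)
    rw [le_div_iff₀ hLpos] at h; linarith
  have hφσ : (K + 1) * φ ≤ σ₀ := by
    have h : φ ≤ σ₀ / (K + 1) := (min_le_right _ _).trans (min_le_left _ _)
    rw [le_div_iff₀ (by positivity)] at h; linarith
  have hφe : φ ^ (8 * α - 2) ≤ 1 / (Real.pi ^ 2 * C₁ ^ 2 * (K ^ α) ^ 2 + 1) := by
    have h : φ ≤ (1 / (Real.pi ^ 2 * C₁ ^ 2 * (K ^ α) ^ 2 + 1)) ^ (8 * α - 2)⁻¹ :=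
      (min_le_right _ _).trans ((min_le_right _ _).trans (min_le_left _ _))
    calc φ ^ (8 * α - 2) ≤ ((1 / (Real.pi ^ 2 * C₁ ^ 2 * (K ^ α) ^ 2 + 1)) ^ (8 * α - 2)⁻¹) ^ (8 * α - 2) :=
        Real.rpow_le_rpow hφ0.le h he.le
      _ = 1 / (Real.pi ^ 2 * C₁ ^ 2 * (K ^ α) ^ 2 + 1) := Real.rpow_inv_rpow (by positivity) he.ne'
  have hηM : (Real.pi ^ 2 * C₁ ^ 2 * (K ^ α) ^ 2 + 1) * φ ^ (8 * α - 2) ≤ 1 := by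
    have := mul_le_mul_of_nonneg_left hφe hM1.le
    rwa [mul_one_div_cancel hM1.ne'] at this
  have hφs : (2 * L * |C| * K ^ α + 1) * φ ≤ 1 := by
    have h : φ ≤ 1 / (2 * L * |C| * K ^ α + 1) := (min_le_right _ _).trans ((min_le_right _ _).trans (min_le_right _ _))
    rw [le_div_iff₀ hM2] at h; linarith
  -- the witness: the centre twist of the two-link configuration
  obtain ⟨a, ha⟩ := exists_su2Quat_eq _ (normSq_axisI φ)
  obtain ⟨b, hb⟩ := exists_su2Quat_eq _ (normSq_axisJ φ)
  have hsin0 : 0 ≤ Real.sin φ := Real.sin_nonneg_of_nonneg_of_le_pi hφ0.le (by linarith [Real.pi_gt_three])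
  have hsin4 : Real.sin φ ^ 4 ≤ φ ^ 4 := pow_le_pow_left₀ hsin0 (Real.sin_le hφ0.le) 4
  have hφ4 : φ ^ 4 ≤ φ := pow_le_of_le_one hφ0.le hφ1 (by norm_num)
  set S := wilsonAction su2Rep (twist 2 negOne (twoLinkCfg (L := L) a b)) with hS
  have hS0 : 0 ≤ S := wilsonAction_su2_nonneg_lat _
  have hSφ : S ≤ K * φ ^ 4 := by
    rw [hS, wilsonAction_twist_of_mem_center su2Rep 2 negOne_mem_center]
    exact (wilsonAction_twoLinkCfg_le ha hb).trans (mul_le_mul_of_nonneg_left hsin4 hK0)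
  have hSσ : S ≤ σ₀ := by
    have : K * φ ^ 4 ≤ K * φ := mul_le_mul_of_nonneg_left hφ4 hK0
    linarith
  obtain ⟨g, c, hclose⟩ := H _ hSσ
  set δ := C * S ^ α with hδ
  have hδ0 : 0 ≤ δ := (frobNorm_nonneg _).trans (hclose ((0 : Site 3 L), 0))
  -- the modulus in terms of `φ`
  have hSα : S ^ α ≤ K ^ α * φ ^ (4 * α) :=
    calc S ^ α ≤ (K * φ ^ 4) ^ α := Real.rpow_le_rpow hS0 hSφ hα0
      _ = K ^ α * (φ ^ 4) ^ α := Real.mul_rpow hK0 (by positivity)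
      _ = K ^ α * φ ^ (4 * α) := by
        rw [show φ ^ 4 = φ ^ ((4 : ℕ) : ℝ) from (Real.rpow_natCast φ 4).symm, ← Real.rpow_mul hφ0.le]; norm_num
  have hφ4α : φ ^ (4 * α) ≤ φ := by
    have := Real.rpow_le_rpow_of_exponent_ge hφ0 hφ1 h4α
    rwa [Real.rpow_one] at this
  have hε : (L : ℝ) * δ ≤ 1 / 2 := by
    have h1 : δ ≤ |C| * (K ^ α * φ) :=
      calc δ = C * S ^ α := hδ
        _ ≤ |C| * S ^ α := mul_le_mul_of_nonneg_right (le_abs_self C) (Real.rpow_nonneg hS0 α)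
        _ ≤ |C| * (K ^ α * φ ^ (4 * α)) := mul_le_mul_of_nonneg_left hSα (abs_nonneg C)
        _ ≤ |C| * (K ^ α * φ) := mul_le_mul_of_nonneg_left (mul_le_mul_of_nonneg_left hφ4α hKα0) (abs_nonneg C)
    have h2 : (L : ℝ) * δ ≤ L * (|C| * (K ^ α * φ)) := mul_le_mul_of_nonneg_left h1 hLpos.le
    nlinarith [mul_nonneg (mul_nonneg (mul_nonneg hLpos.le (abs_nonneg C)) hKα0) hφ0.le]
  -- closeness to the constant configuration, and the five loop facts at the origin
  have hclose' : ∀ e, frobNorm (((gaugeTransform g (twist 2 negOne (twoLinkCfg (L := L) a b)) e : SU2) : Matrix (Fin 2) (Fin 2) ℂ) -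
      (((fun e' : Edge 3 L => c e'.2) e : SU2) : Matrix (Fin 2) (Fin 2) ℂ)) ≤ δ :=
    fun e => hclose e
  have hd0 := frobNorm_lineHolonomy_sub_le hclose' 0 L 0
  have hd1 := frobNorm_lineHolonomy_sub_le hclose' 1 L 0
  have hd2 := frobNorm_lineHolonomy_sub_le hclose' 2 L 0
  rw [lineHolonomy_gaugeTransform_period, lineHolonomy_twist_twoLinkCfg_zero, lineHolonomy_const] at hd0
  rw [lineHolonomy_gaugeTransform_period, lineHolonomy_twist_twoLinkCfg_one, lineHolonomy_const] at hd1
  rw [lineHolonomy_gaugeTransform_period, lineHolonomy_twist_twoLinkCfg_two, lineHolonomy_const, conj_negOne] at hd2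
  have hp0 := frobNorm_plaquetteHolonomy_sub_le_of_forall hclose' 0 0 2
  have hp1 := frobNorm_plaquetteHolonomy_sub_le_of_forall hclose' 0 1 2
  rw [plaquetteHolonomy_gaugeTransform, plaquetteHolonomy_twist_twoLinkCfg_two negOne_mem_center a b 0 (by decide), mul_one, mul_inv_cancel,
    plaquetteHolonomy_const, OneMemClass.coe_one] at hp0 hp1
  -- the linear lower bound against the `S^α` upper bound
  have hsL : 0 < Real.sin (L * φ) := Real.sin_pos_of_pos_of_lt_pi (by positivity) (by linarith)
  have hkey := sin_sq_le_of_near_const hm hLnat ha hb hsL hε hd0 hd1 hd2 hp0 hp1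
  have hjordan : 2 / Real.pi * (L * φ) ≤ Real.sin (L * φ) := Real.mul_le_sin (by positivity) hφL
  have hφpow : (φ ^ (4 * α)) ^ 2 = φ ^ 2 * φ ^ (8 * α - 2) := by
    rw [← Real.rpow_mul_natCast hφ0.le, show 4 * α * ((2 : ℕ) : ℝ) = 2 + (8 * α - 2) by push_cast; ring, Real.rpow_add hφ0,
      Real.rpow_two]
  have hδ' : ((1 + 2 * L) * δ) ^ 2 ≤ C₁ ^ 2 * ((K ^ α) ^ 2 * (φ ^ 2 * φ ^ (8 * α - 2))) :=
    calc ((1 + 2 * L) * δ) ^ 2 = C₁ ^ 2 * (S ^ α) ^ 2 := by rw [hδ, hC₁]; ring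
      _ ≤ C₁ ^ 2 * (K ^ α * φ ^ (4 * α)) ^ 2 :=
        mul_le_mul_of_nonneg_left (pow_le_pow_left₀ (Real.rpow_nonneg hS0 α) hSα 2) (sq_nonneg C₁)
      _ = C₁ ^ 2 * ((K ^ α) ^ 2 * (φ ^ 2 * φ ^ (8 * α - 2))) := by rw [mul_pow (K ^ α), hφpow]
  exact flatProximity_endgame_rpow hLpos hφ0 hηM hjordan hkey hδ'

/-- ★ The `√σ` form (`α = 1/2`), as written in LOWER-BLUEPRINT §5 («after gauge fixing all links within `O(√σ)` of a constant»): false at every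
even `L`. [cite: Luscher1983, §2] -/
theorem constProximity_sqrt_false (L : ℕ) [NeZero L] (hLe : Even L) :
    ¬ ∃ C σ₀ : ℝ, 0 < σ₀ ∧ ∀ U : GaugeConfig 3 L SU2, wilsonAction su2Rep U ≤ σ₀ →
        ∃ (g : Site 3 L → SU2) (c : Fin 3 → SU2),
          ∀ e, frobNorm (((gaugeTransform g U e : SU2) : Matrix (Fin 2) (Fin 2) ℂ) - ((c e.2 : SU2) : Matrix (Fin 2) (Fin 2) ℂ)) ≤ C * Real.sqrt (wilsonAction su2Rep U) := by
  rintro ⟨C, σ₀, hσ₀, H⟩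
  refine constProximity_rpow_false L hLe (α := 1 / 2) (by norm_num) ⟨C, σ₀, hσ₀, fun U hU => ?_⟩
  obtain ⟨g, c, h⟩ := H U hU
  exact ⟨g, c, fun e => by rw [← Real.sqrt_eq_rpow]; exact h e⟩

end Main

end Summit.QuantumFields.YangMills.Theorems.TwistedTraceScaling.Negative.R9

end
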